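import Mathlib
import Summits.Ventures.PercRepro2.Defs
import Summits.Ventures.PercRepro2.Independence
import Summits.Ventures.PercRepro2.Graph
import Summits.Ventures.PercRepro2.Induced
import Summits.Ventures.PercRepro2.DisagreementSum
import Summits.Ventures.PercRepro2.DisagreementPinned
import Summits.Ventures.PercRepro2.TwoCopyBHK
import Summits.Ventures.PercRepro2.HullDefs
import Summits.Ventures.PercRepro2.HullFlip
import Summits.Ventures.PercRepro2.HullTheoremA
import Summits.Ventures.PercRepro2.HullCount
import Summits.Ventures.PercRepro2.SwitchDefs

/-!
# (BASE) as `|P| ≤ |M1|`, and the `C_R(h)`-local injection in Hall form (blind cell PercRepro2,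
typer-1; mine-2 g8 `MINE2-SWITCHING.md` §0, §2, §7 ROUND 2; lead g11 ASSIGNMENTS v11.8 (2))

On the typed minor `(G, z)` (free edges `G`, the rest pinned to `z`; blue graph `flipOn G ζ`) with
`P = {Q̂, o ∈ RL ∖ BL, b ∈ RH ∖ BH}` and `M1 = {Q̂, o ∈ RL ∖ BL, b ∈ BH ∖ RH}` (`Switch.PlusSet`,
`Switch.MinusSet`):

* `fibreP`, `fibreM`: the `+1` / `−1` configurations of the fibre; **`hullSumG_eq_card`**: the hull
  sum of (BASE) is `|M1| − |P|` (the colour swap `flipOn G` on the fibre, then the common part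
  `b ∈ RH ∩ BH` cancels) — so row 2′HULL (i) = (BASE) on every minor reads `|P| ≤ |M1|` fibre by fibre
  (`hullRow_iff_card_le`);
* `LocalAt ζ ζ′`: `ζ′` recolours only free edges at `C_R(h)(ζ)`; **`LocalInjection`** (mine-2's
  census fact, PROMOTED by lead g11): on every fibre an injection `P → M1` that recolours only free
  edges at `C_R(h)`; **`LocalHall`**: its Hall condition; **`localInjection_iff_localHall`** by
  Mathlib's marriage theorem (`Finset.all_card_le_biUnion_card_iff_exists_injective`);
* **`hullRow_of_localInjection`** / **`crossCount_of_localInjection`**: the local injection gives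
  (BASE) on every minor.

Census (mine-2, exact maximum matching per fibre): 0 Hall failures on every connected graph with
`n = 6, m ≤ 13` and `n = 7, m ≤ 11` (598 graphs, every marking, typing and colouring).
-/

namespace Summit.Ventures.PercRepro2

namespace Switch

open Hull

open scoped Classical

variable {V : Type*} {E : Type*} [Fintype E] [DecidableEq E]

/-! ## The two halves of a fibre -/

/-- The `+1` configurations of the fibre `(G, z)`. -/
noncomputable def fibreP (ends : E → Sym2 V) (G : Finset E) (z : Config E) (l h o b : V) :
    Finset (Config E) :=
  Finset.univ.filter fun ζ => (∀ e, e ∉ G → ζ e = z e) ∧ PlusSet ends G ζ l h o b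

/-- The `−1` configurations (with the side of `o` unchanged) of the fibre `(G, z)`. -/
noncomputable def fibreM (ends : E → Sym2 V) (G : Finset E) (z : Config E) (l h o b : V) :
    Finset (Config E) :=
  Finset.univ.filter fun ζ => (∀ e, e ∉ G → ζ e = z e) ∧ MinusSet ends G ζ l h o b

omit [Fintype E] in
/-- `Q̂` is `h ∉ hullG`. -/
lemma qhat_iff (ends : E → Sym2 V) (G : Finset E) (ζ : Config E) (l h : V) :
    Qhat ends G ζ l h ↔ h ∉ hullG ends G ζ l := by
  simp only [Qhat, hullG, Set.mem_union, not_or]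

section Card

variable {R : Type*} [Field R] [LinearOrder R]

/-- The fibre sum `Σ_{ζ = z off G} 1[Q̂] · 1[o ∈ RL ∖ BL] · 1[b ∈ BH]` on the minor. -/
noncomputable def sumRB (R : Type*) [Ring R] (ends : E → Sym2 V) (G : Finset E) (z : Config E)
    (l h o b : V) : R :=
  ∑ ζ : Config E, if (∀ e, e ∉ G → ζ e = z e) ∧ Qhat ends G ζ l h ∧
      (o ∈ cluster ends ζ l ∧ o ∉ cluster ends (flipOn G ζ) l) ∧
      b ∈ cluster ends (flipOn G ζ) h then 1 else 0

/-- The fibre sum `Σ_{ζ = z off G} 1[Q̂] · 1[o ∈ RL ∖ BL] · 1[b ∈ RH]` on the minor. -/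
noncomputable def sumRR (R : Type*) [Ring R] (ends : E → Sym2 V) (G : Finset E) (z : Config E)
    (l h o b : V) : R :=
  ∑ ζ : Config E, if (∀ e, e ∉ G → ζ e = z e) ∧ Qhat ends G ζ l h ∧
      (o ∈ cluster ends ζ l ∧ o ∉ cluster ends (flipOn G ζ) l) ∧
      b ∈ cluster ends ζ h then 1 else 0

omit [LinearOrder R] in
/-- The hull sum is `Σ 1[Q̂, o ∈ RL∖BL, b ∈ BH] − Σ 1[Q̂, o ∈ RL∖BL, b ∈ RH]`: the `o ∈ BL ∖ RL` half of
the side sign is carried to `o ∈ RL ∖ BL` by the colour swap `flipOn G` of the fibre. -/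
lemma hullSumG_eq_sumRB_sub_sumRR (ends : E → Sym2 V) (G : Finset E) (z : Config E)
    (l h o b : V) :
    hullSumG R ends G z l o h b = sumRB R ends G z l h o b - sumRR R ends G z l h o b := by
  -- split the side sign
  have hsplit : hullSumG R ends G z l o h b =
      (∑ ζ : Config E, if (∀ e, e ∉ G → ζ e = z e) ∧ Qhat ends G ζ l h ∧
          (o ∈ cluster ends ζ l ∧ o ∉ cluster ends (flipOn G ζ) l) ∧
          b ∈ cluster ends (flipOn G ζ) h then 1 else 0) -
        ∑ ζ : Config E, if (∀ e, e ∉ G → ζ e = z e) ∧ Qhat ends G ζ l h ∧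
          (o ∈ cluster ends (flipOn G ζ) l ∧ o ∉ cluster ends ζ l) ∧
          b ∈ cluster ends (flipOn G ζ) h then 1 else 0 := by
    unfold hullSumG sideSignG
    rw [← Finset.sum_sub_distrib]
    refine Finset.sum_congr rfl fun ζ _ => ?_
    rw [qhat_iff]
    by_cases hf : ∀ e, e ∉ G → ζ e = z e
    · by_cases hQ : h ∉ hullG ends G ζ l <;>
        by_cases hRo : Conn ends ζ l o <;> by_cases hBo : Conn ends (flipOn G ζ) l o <;>
        by_cases hc : Conn ends (flipOn G ζ) h b <;>
        simp [eq_true hf, hQ, hRo, hBo, hc, mem_cluster]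
    · simp [eq_false hf]
  -- the second sum is `sumRR` by the colour swap
  have hswap : (∑ ζ : Config E, if (∀ e, e ∉ G → ζ e = z e) ∧ Qhat ends G ζ l h ∧
          (o ∈ cluster ends (flipOn G ζ) l ∧ o ∉ cluster ends ζ l) ∧
          b ∈ cluster ends (flipOn G ζ) h then 1 else 0) = sumRR R ends G z l h o b := by
    unfold sumRR
    refine Fintype.sum_bijective (flipOn G) (Function.Involutive.bijective (flipOn_flipOn G)) _ _ ?_
    intro ζ
    rw [flipOn_flipOn]
    have hQ : Qhat ends G (flipOn G ζ) l h ↔ Qhat ends G ζ l h := by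
      rw [qhat_iff, qhat_iff, hullG_flipOn]
    simp only [fibre_flipOn, hQ]
  rw [hsplit, hswap]
  rfl

omit [LinearOrder R] in
/-- `Σ 1[Q̂, o ∈ RL∖BL, b ∈ BH] − Σ 1[Q̂, o ∈ RL∖BL, b ∈ RH] = |M1| − |P|` (the part `b ∈ RH ∩ BH` cancels). -/
lemma sumRB_sub_sumRR_eq_card (ends : E → Sym2 V) (G : Finset E) (z : Config E) (l h o b : V) :
    sumRB R ends G z l h o b - sumRR R ends G z l h o b =
      ((fibreM ends G z l h o b).card : R) - (fibreP ends G z l h o b).card := by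
  unfold sumRB sumRR fibreM fibreP
  rw [Finset.card_filter, Finset.card_filter, Nat.cast_sum, Nat.cast_sum, ← Finset.sum_sub_distrib,
    ← Finset.sum_sub_distrib]
  refine Finset.sum_congr rfl fun ζ _ => ?_
  simp only [MinusSet, PlusSet]
  by_cases hf : ∀ e, e ∉ G → ζ e = z e <;> by_cases hQ : Qhat ends G ζ l h <;>
    by_cases hR : o ∈ cluster ends ζ l ∧ o ∉ cluster ends (flipOn G ζ) l <;>
    by_cases hbB : b ∈ cluster ends (flipOn G ζ) h <;> by_cases hbR : b ∈ cluster ends ζ h <;>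
    simp [hf, hQ, hR, hbB, hbR]

omit [LinearOrder R] in
/-- **The hull sum of (BASE) is `|M1| − |P|`** on every fibre. -/
theorem hullSumG_eq_card (ends : E → Sym2 V) (G : Finset E) (z : Config E) (l h o b : V) :
    hullSumG R ends G z l o h b =
      ((fibreM ends G z l h o b).card : R) - (fibreP ends G z l h o b).card := by
  rw [hullSumG_eq_sumRB_sub_sumRR, sumRB_sub_sumRR_eq_card]

/-- **Row 2′HULL (i) = (BASE) on every minor is `|P| ≤ |M1|` fibre by fibre.** -/
theorem hullRow_iff_card_le [IsStrictOrderedRing R] (ends : E → Sym2 V) (l h o b : V) :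
    HullRow R ends l o h b ↔
      ∀ (G : Finset E) (z : Config E),
        (fibreP ends G z l h o b).card ≤ (fibreM ends G z l h o b).card := by
  unfold HullRow
  constructor
  · intro hr G z
    have h := hr G z
    rw [hullSumG_eq_card, sub_nonneg] at h
    exact_mod_cast h
  · intro hc G z
    rw [hullSumG_eq_card, sub_nonneg]
    exact_mod_cast hc G z

end Card

/-! ## The `C_R(h)`-local injection -/

omit [Fintype E] in
/-- `ζ′` recolours only free edges at `C_R(h)(ζ)` (mine-2 §2: interior and boundary edges of
the red cluster of `h`). -/
def LocalAt (ends : E → Sym2 V) (G : Finset E) (h : V) (ζ ζ' : Config E) : Prop :=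
  ∀ e, ζ' e ≠ ζ e → e ∈ G ∧ e ∈ touches ends (cluster ends ζ h)

/-- The `−1` configurations reachable from `ζ` by recolouring only free edges at `C_R(h)(ζ)`. -/
noncomputable def localTargets (ends : E → Sym2 V) (G : Finset E) (z : Config E) (l h o b : V)
    (ζ : Config E) : Finset (Config E) :=
  (fibreM ends G z l h o b).filter fun ζ' => LocalAt ends G h ζ ζ'

/-- **The `C_R(h)`-local injection** (mine-2 §2 / ROUND 2, PROMOTED): on every fibre `(G, z)` there
is an injection `P → M1` whose image recolours only free edges at `C_R(h)`. -/
def LocalInjection (ends : E → Sym2 V) (l h o b : V) : Prop :=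
  ∀ (G : Finset E) (z : Config E),
    ∃ f : {ζ // ζ ∈ fibreP ends G z l h o b} → Config E,
      Function.Injective f ∧ ∀ x, f x ∈ localTargets ends G z l h o b x.1

/-- **Hall's condition** for the local injection: every set `s` of `+1` configurations has at least
`|s|` local `−1` targets. -/
def LocalHall (ends : E → Sym2 V) (l h o b : V) : Prop :=
  ∀ (G : Finset E) (z : Config E) (s : Finset {ζ // ζ ∈ fibreP ends G z l h o b}),
    s.card ≤ (s.biUnion fun x => localTargets ends G z l h o b x.1).card

/-- **Marriage theorem**: the local injection exists iff Hall's condition holds. -/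
theorem localInjection_iff_localHall (ends : E → Sym2 V) (l h o b : V) :
    LocalInjection ends l h o b ↔ LocalHall ends l h o b := by
  constructor
  · intro hi G z
    exact (Finset.all_card_le_biUnion_card_iff_exists_injective _).2 (hi G z)
  · intro hh G z
    exact (Finset.all_card_le_biUnion_card_iff_exists_injective _).1 (hh G z)

/-- An injection `P → M1` on every fibre gives `|P| ≤ |M1|` on every fibre. -/
theorem card_le_of_localInjection (ends : E → Sym2 V) (l h o b : V)
    (hi : LocalInjection ends l h o b) (G : Finset E) (z : Config E) :
    (fibreP ends G z l h o b).card ≤ (fibreM ends G z l h o b).card := by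
  obtain ⟨f, hf, hmem⟩ := hi G z
  have key := Finset.card_le_card_of_injOn f
    (s := (Finset.univ : Finset {ζ // ζ ∈ fibreP ends G z l h o b}))
    (t := fibreM ends G z l h o b)
    (fun x _ => (Finset.mem_filter.1 (hmem x)).1) (fun x _ y _ hxy => hf hxy)
  rwa [Finset.card_univ, Fintype.card_coe] at key

section Base

variable {R : Type*} [Field R] [LinearOrder R] [IsStrictOrderedRing R]

/-- **The local injection gives row 2′HULL (i)** = (BASE) on every minor. -/
theorem hullRow_of_localInjection (ends : E → Sym2 V) (l h o b : V)
    (hi : LocalInjection ends l h o b) : HullRow R ends l o h b :=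
  (hullRow_iff_card_le ends l h o b).2 (card_le_of_localInjection ends l h o b hi)

/-- **The local injection gives (BASE) on every minor** (p1's `CrossCount`). -/
theorem crossCount_of_localInjection (ends : E → Sym2 V) (l h o b : V)
    (hi : LocalInjection ends l h o b) : CrossCount R ends l h o b :=
  (hullRow_iff_crossCount ends l o h b).1 (hullRow_of_localInjection ends l h o b hi)

end Base

end Switch

end Summit.Ventures.PercRepro2
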